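import Summits.AtomisticToContinuum.Crystallization.Theses.IsometryAtoms
import Summits.AtomisticToContinuum.Crystallization.Theorems.MinimisingLawsCohesive.Negative.OnePointMixtures
import Summits.AtomisticToContinuum.Crystallization.Theorems.MinimisingLawsCohesive.Negative.RootedComb
import Summits.AtomisticToContinuum.Crystallization.Theorems.PalmUnimodularRigidityMinimiserShellsEnergyFloor
import Literature.Geometry.DiscreteGeometry.MultiregularPointSystems

/-!
# Disproof of `MinimisingLawsCohesive` — findings (cdisprove seat, cycle 1, 2026-08-17)

Crux `Summit.AtomisticToContinuum.Crystallization.Theses.IsometryAtoms.MinimisingLawsCohesive`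
(stmt-AtomisticToContinuum-15777, route `IsometryAtoms`, rank 3, COHESION):
`∀ δ > 0, ∀ P` probability law on rooted configurations `μ : Measure ℝ³`, a.s.
`IsRootedHardCore δ`, `IsPointStationaryLaw` (Mecke), `∫ rootEnergy V_LJ dP ≤ e* := ⨅_Q e_LJ(Q)`
⟹ `P`-a.s. `∃ R₀ ∀ z ∃ y, μ {y} ≠ 0 ∧ dist z y ≤ R₀` (relatively dense).

VERDICT OF THIS CYCLE: **no kill**; the crux resists every cheap attack, and the reason is now a
theorem: the energy floor `e* ≤ E_P[rootEnergy]` is PROVED in the tree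
(`PalmUnimodularRigidityMinimiserShells.EnergyFloor.stub_energyFloor`, item 9229), so
(`not_minimisingLawsCohesive_iff`, §1) a refutation is EXACTLY a point-stationary a.s.-hard-core
probability law with mean root energy `= e*` (an exact infinite-volume ground state in Palm form)
charging configurations with unbounded holes — and no exact law other than the abstract
Benjamini–Schramm limit of ground states (`exists_minimising_law`) is constructible while the
optimal periodic Lennard-Jones configuration and the value of `e*` are unknown (§6).

## Index (everything outside §6 is sorry-free)

* §1 THE FLOOR CLOSES THE STABILITY HALF (new; proposed as `Negative/ExactFace.lean`, p169375):
  `energyFloor'` (tree theorem in crux vocabulary); `minimising_iff_exact` (under the frame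
  `∫ ≤ e* ↔ ∫ = e*`); `isLeast_eStar` (`e*` is the least mean root energy over the frame, attained);
  `minimisingLawsCohesive_iff_exact` (crux ↔ cohesion of EXACT laws — the stability conjunct of the
  landed `minimisingLawsCohesive_iff_stable_and_exact` is discharged); `not_minimisingLawsCohesive_iff`
  (KILL SHAPE, an iff: `¬crux ↔ ∃` exact admissible law not a.s. relatively dense).
* §2 LOAD-BEARING HYPOTHESES — census complete:
  (H_E, energy) landed `OnePointMixtures.not_cohesive_without_energy`, sharp threshold
  `not_cohesive_at_relaxed_threshold`; (H_S, Mecke) landed `RootedComb.not_cohesive_without_stationarity`;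
  (H_P, `IsProbabilityMeasure`) NEW `minimisingLawsCohesive_false_without_probability` (= `Negative/ExactFace
  .not_cohesive_without_probability`, p169375; a FINITE
  point-stationary hard-core law of mass 2 at energy `e*` charging `δ_0`; sub-probability laws are
  vacuously fine, §2); (H_C, hard core) NEW `minimisingLawsCohesive_false_without_hardCore` (same name in
  `Negative/DoubledDimer.lean`, p169374; the
  DOUBLED DIMER: multiplicity `2³³` at the root and at one neighbour at distance 1 — point-stationary,
  energy `≤ e*` through the `V_LJ(0) = 0` junk of coincident particles, bounded support; so the clause
  is what neutralises both multiplicity and the `0⁻¹ = 0` convention); (H_δ, `0 < δ`) NOT load-bearing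
  for any cheap witness: with `δ ≤ 0` the clause still forces SIMPLE counting measures `count|S`, and
  LJ stability holds without separation (comment in §2).
* §3 STRENGTHENINGS: relaxed threshold false (landed); homogeneity in `P` false (= H_P); uniform
  radius `R₀(δ)` and "exact ⇒ Delone" UNDECIDABLE here without an explicit exact law (comment).
* §4 `-- Targets`: none served (payload `targets = []`, `stuck_stubs = []`).
* §5 `-- Line purity_stacking` (PICKED): all seven stubs (A measurableClass, G symDiscontinuous,
  F groupStructure, B pureExhaustion, C finiteOrbitsOfCharged, D slabOrDense, E noSlabs) SURVIVE the
  cheap attacks (degenerate `Y = ∅`/singleton/finite/coplanar, helical rod, half-crystal, canopy-type,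
  aperiodic stackings; the Mecke mass formula of (C) re-derived by hand); two Lean calibrations.
* §6 NEAR-MISS / WHY IT RESISTS: `KillTarget` (def, = RHS of the kill-shape iff) with the
  obstruction list; no `sorry` is used anywhere in this file.

Barriers consulted (`Literature/Barriers/AtomisticToContinuum/`): `IcosahedralClusters`,
`TetrahedralFrustration`, `KissingTwelveDegeneracy`, `StickySphereClusters` (one-centre / finite-`N`
frustration: why SITEWISE pricing of cavity walls fails — they bite line `birth`, not a
counterexample: a frustrated site is not a law at `e*`); `SutoDegenerateGroundStates` (degenerate
GSCs of Fourier-positive potentials are UNIONS OF LATTICES — relatively dense: the catalogued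
degeneracy attacks PURITY `MinimisingLawsHaveAtoms`, not cohesion); `AperiodicTilingGroundStates`,
`MostHomogeneousGroundStates` (same: diffuse, but cohesive). No catalogued barrier yields a porous or
filmy exact ground state.
-/

noncomputable section

namespace Summit.AtomisticToContinuum.Crystallization.Cruxes.MinimisingLawsCohesive.Disproof

open MeasureTheory Set Filter
open scoped ENNReal Topology
open Literature.MathematicalPhysics.StatisticalMechanics Literature.Probability.Process
open Summit.AtomisticToContinuum.Crystallization.Theses.IsometryAtoms (MinimisingLawsCohesive)
open Summit.AtomisticToContinuum.Crystallization.Theorems.ChargedEnergyGapNegative (eStar)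
open Summit.AtomisticToContinuum.Crystallization.Theorems.MinimisingLawsCohesive.Negative.OnePointMixtures
  (exists_minimising_law integrable_of_integral_le_eStar rootEnergy_ae_eq_zero_dirac
    not_relDense_dirac_zero minimisingLawsCohesive_iff_stable_and_exact)
open Summit.AtomisticToContinuum.Crystallization.Theorems.LayeredLawsSelectHcp.Negative.DiracLaws
  (measure_eq_of_compl_null count_restrict_compl count_restrict_singleton ae_dirac_of_mem
    lintegral_dirac_of_mem integral_dirac_of_mem)
open Summit.AtomisticToContinuum.Crystallization.Theorems.NearFieldConvexity.Negative.LoadBearing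
  (neg_le_eStar)

/-- Euclidean `3`-space. -/
local notation "E3" => EuclideanSpace ℝ (Fin 3)

/-- `μ` is **relatively dense** (verbatim the conclusion of the crux). -/
def RelDense (μ : Measure E3) : Prop :=
  ∃ R₀ : ℝ, ∀ z : E3, ∃ y : E3, μ {y} ≠ 0 ∧ dist z y ≤ R₀

/-! ## §1 The floor closes the stability half: the crux is cohesion of EXACT laws -/

/-- **The energy floor, in the vocabulary of the crux** (tree theorem
`PalmUnimodularRigidityMinimiserShells.EnergyFloor.stub_energyFloor`, item 9229, random-grid mass
transport): `e* ≤ E_P[rootEnergy]` for every point-stationary a.s.-`δ`-hard-core probability law.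
[folklore] -/
theorem energyFloor' {δ : ℝ} (hδ : 0 < δ) (P : Measure (Measure E3)) [hP : IsProbabilityMeasure P]
    (hhc : ∀ᵐ μ ∂P, IsRootedHardCore δ μ) (hst : IsPointStationaryLaw P) :
    eStar ≤ ∫ μ, rootEnergy lennardJones μ ∂P :=
  Summit.AtomisticToContinuum.Crystallization.Theorems.PalmUnimodularRigidityMinimiserShells.EnergyFloor.stub_energyFloor
    δ hδ P hP hhc hst

/-- **Minimising = exact.** Under the frame, the minimising hypothesis `∫ rootEnergy ≤ e*` holds iff
the mean root energy is EXACTLY `e*`. [folklore] -/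
theorem minimising_iff_exact {δ : ℝ} (hδ : 0 < δ) (P : Measure (Measure E3)) [IsProbabilityMeasure P]
    (hhc : ∀ᵐ μ ∂P, IsRootedHardCore δ μ) (hst : IsPointStationaryLaw P) :
    (∫ μ, rootEnergy lennardJones μ ∂P) ≤ eStar ↔ (∫ μ, rootEnergy lennardJones μ ∂P) = eStar :=
  ⟨fun h => le_antisymm h (energyFloor' hδ P hhc hst), fun h => h.le⟩

/-- **`e*` is the least mean root energy over the frame, and it is attained** (by the
Benjamini–Schramm limit law of Lennard-Jones ground states, `exists_minimising_law`): the periodic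
infimum `⨅_Q e_LJ(Q)` IS the minimum of `E_P[rootEnergy]` over point-stationary hard-core probability
laws. So the frame of the crux is the canonical one (no gap between "≤ periodic infimum" and
"minimising among admissible laws"). [folklore] -/
theorem isLeast_eStar :
    IsLeast {e : ℝ | ∃ δ : ℝ, 0 < δ ∧ ∃ P : Measure (Measure E3), IsProbabilityMeasure P ∧
      (∀ᵐ μ ∂P, IsRootedHardCore δ μ) ∧ IsPointStationaryLaw P ∧
      ∫ μ, rootEnergy lennardJones μ ∂P = e} eStar := by
  refine ⟨exists_minimising_law, ?_⟩
  rintro e ⟨δ, hδ, P, hP, hhc, hst, rfl⟩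
  exact energyFloor' hδ P hhc hst

/-- **The crux is cohesion of exact laws.** With the floor a tree theorem, the stability conjunct of
the landed splitting `minimisingLawsCohesive_iff_stable_and_exact` is discharged:
`MinimisingLawsCohesive ↔` every point-stationary a.s.-hard-core probability law with
`E_P[rootEnergy] = e*` is a.s. relatively dense. [folklore] -/
theorem minimisingLawsCohesive_iff_exact :
    MinimisingLawsCohesive ↔
      ∀ δ : ℝ, 0 < δ → ∀ P : Measure (Measure E3), IsProbabilityMeasure P →
        (∀ᵐ μ ∂P, IsRootedHardCore δ μ) → IsPointStationaryLaw P →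
        (∫ μ, rootEnergy lennardJones μ ∂P) = eStar → ∀ᵐ μ ∂P, RelDense μ := by
  rw [minimisingLawsCohesive_iff_stable_and_exact]
  exact ⟨fun h => h.2, fun h => ⟨fun δ hδ P hP hhc hst => energyFloor' hδ P hhc hst, h⟩⟩

/-- **KILL SHAPE (iff).** The crux fails iff there is a point-stationary a.s.-hard-core probability
law with mean root energy EXACTLY `e*` that charges non-relatively-dense configurations. Nothing
cheaper can refute it (mixtures, relaxed energies, non-stationary samples are all excluded by the
landed Negative lemmas), and nothing more is needed. [folklore] -/
theorem not_minimisingLawsCohesive_iff :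
    ¬ MinimisingLawsCohesive ↔
      ∃ δ : ℝ, 0 < δ ∧ ∃ P : Measure (Measure E3), IsProbabilityMeasure P ∧
        (∀ᵐ μ ∂P, IsRootedHardCore δ μ) ∧ IsPointStationaryLaw P ∧
        (∫ μ, rootEnergy lennardJones μ ∂P) = eStar ∧ ¬ ∀ᵐ μ ∂P, RelDense μ := by
  rw [minimisingLawsCohesive_iff_exact]
  constructor
  · intro h
    by_contra hne
    refine h fun δ hδ P hP hhc hst hE => ?_
    by_contra hbad
    exact hne ⟨δ, hδ, P, hP, hhc, hst, hE, hbad⟩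
  · rintro ⟨δ, hδ, P, hP, hhc, hst, hE, hbad⟩ h
    exact hbad (h δ hδ P hP hhc hst hE)

/-! ## §2 Load-bearing hypotheses: the census completed

(H_E) energy and (H_S) point-stationarity: landed (`not_cohesive_without_energy`,
`not_cohesive_at_relaxed_threshold`, `not_cohesive_without_stationarity`), not repeated.

(H_δ) `0 < δ`: with `δ ≤ 0` the clause `IsRootedHardCore δ μ` still says `μ = count|S`, `0 ∈ S`
(a SIMPLE counting measure, separation vacuous). Lennard-Jones stability `N e* ≤ 𝓔_N`
(`card_mul_eStar_le`) needs no separation, so no non-separated simple witness can go below `e*`;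
the cheap Dirac laws at non-discrete subgroups have non-integrable root energy (junk `0 > e*`).
No witness found; positivity of `δ` is plausibly a convenience (local finiteness, compactness),
not load-bearing for the truth value. -/

/-- The crux with `IsProbabilityMeasure P` weakened to `IsFiniteMeasure P` (everything else
verbatim). -/
def MinimisingLawsCohesiveWithoutProbability : Prop :=
  ∀ δ : ℝ, 0 < δ → ∀ P : Measure (Measure E3), IsFiniteMeasure P →
    (∀ᵐ μ ∂P, IsRootedHardCore δ μ) → IsPointStationaryLaw P →
    (∫ μ, rootEnergy lennardJones μ ∂P) ≤
      (⨅ Q : PeriodicConfiguration 3, Q.energyPerParticle lennardJones) →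
    ∀ᵐ μ ∂P, ∃ R₀ : ℝ, ∀ z : E3, ∃ y : E3, μ {y} ≠ 0 ∧ dist z y ≤ R₀

/-- **(H_P) Normalisation is load-bearing.** For a FINITE (not probability) law the crux fails:
`P_min + δ_{δ_0}` (the exact Benjamini–Schramm law of ground states plus the one-point law) is
point-stationary (the Mecke laws form a cone), a.s. hard-core, has mean root energy `e* + 0 ≤ e*`,
and charges the configuration `δ_0`, which is not relatively dense. (For SUB-probability `P` of
mass `c < 1` the statement is vacuously true: `P/c` would be an admissible probability law below
the floor. So exactly `P univ = 1` is used, through the normalisation `e* · P(univ)` of the energy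
threshold.) [folklore] -/
theorem minimisingLawsCohesive_false_without_probability :
    ¬ MinimisingLawsCohesiveWithoutProbability := by
  intro H
  obtain ⟨δ, hδ, P, hP, hhc, hst, hE⟩ := exists_minimising_law
  set D : Measure (Measure E3) := Measure.dirac (Measure.dirac (0 : E3)) with hD
  have hint : Integrable (fun μ : Measure E3 => rootEnergy lennardJones μ) P :=
    integrable_of_integral_le_eStar hE.le
  have hintD : Integrable (fun μ : Measure E3 => rootEnergy lennardJones μ) D :=
    (integrable_congr rootEnergy_ae_eq_zero_dirac).2 (integrable_const _)
  have hED : ∫ μ, rootEnergy lennardJones μ ∂D = 0 := by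
    rw [integral_congr_ae rootEnergy_ae_eq_zero_dirac, integral_const, smul_zero]
  have hfin : IsFiniteMeasure (P + D) := by infer_instance
  have hhc' : ∀ᵐ μ ∂(P + D), IsRootedHardCore δ μ := by
    rw [ae_add_measure_iff]
    exact ⟨hhc, (ae_dirac_dirac_zero (measurableSet_singleton (0 : E3))).mono
      fun μ hμ => hμ ▸ isRootedHardCore_dirac_zero δ⟩
  have hst' : IsPointStationaryLaw (P + D) := hst.add isPointStationaryLaw_dirac_dirac_zero
  have hE' : (∫ μ, rootEnergy lennardJones μ ∂(P + D)) ≤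
      (⨅ Q : PeriodicConfiguration 3, Q.energyPerParticle lennardJones) := by
    rw [integral_add_measure hint hintD, hE, hED, add_zero]
    exact le_rfl
  have hconc := H δ hδ (P + D) hfin hhc' hst' hE'
  rw [ae_iff] at hconc
  set s : Set (Measure E3) := {μ | ¬ ∃ R₀ : ℝ, ∀ z : E3, ∃ y : E3, μ {y} ≠ 0 ∧ dist z y ≤ R₀}
    with hs
  have hmem : Measure.dirac (0 : E3) ∈ s := not_relDense_dirac_zero
  have h1 : (1 : ℝ≥0∞) ≤ D s := by
    refine le_trans (le_of_eq ?_) Measure.le_dirac_apply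
    rw [indicator_of_mem hmem, Pi.one_apply]
  have h2 : (1 : ℝ≥0∞) ≤ (P + D) s := h1.trans (by rw [Measure.add_apply]; exact le_add_self)
  rw [hconc] at h2
  exact one_ne_zero (nonpos_iff_eq_zero.1 h2)


/-! ### (H_C) The hard-core clause: the doubled dimer

Plumbing for two-atom measures with multiplicity, then the witness. -/

/-- `count|{a, b} = δ_a + δ_b` for `a ≠ b`. [folklore] -/
theorem count_restrict_pair {a b : E3} (h : a ≠ b) :
    (Measure.count : Measure E3).restrict {a, b} = Measure.dirac a + Measure.dirac b := by
  classical
  rw [← Finset.coe_pair, count_restrict_coe_finset, Finset.sum_pair h]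

/-- `∫⁻` against `c • (δ_a + δ_b)`. [folklore] -/
theorem lintegral_smul_dirac_add_dirac (c : ℝ≥0∞) (a b : E3) (F : E3 → ℝ≥0∞) :
    ∫⁻ y, F y ∂(c • (Measure.dirac a + Measure.dirac b)) = c * (F a + F b) := by
  rw [lintegral_smul_measure, lintegral_add_measure, lintegral_dirac, lintegral_dirac, smul_eq_mul]

/-- Re-rooting `c • (δ_a + δ_b)` at `y`: `θ_y` moves the atoms to `a - y`, `b - y`. [folklore] -/
theorem map_sub_smul_dirac_add_dirac (c : ℝ≥0∞) (a b y : E3) :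
    (c • (Measure.dirac a + Measure.dirac b)).map (fun z => z - y) =
      c • (Measure.dirac (a - y) + Measure.dirac (b - y)) := by
  rw [Measure.map_smul, Measure.map_add _ _ (measurable_sub_const y),
    Measure.map_dirac' (measurable_sub_const y), Measure.map_dirac' (measurable_sub_const y)]

/-- `rootEnergy` is homogeneous in the configuration measure. [folklore] -/
theorem rootEnergy_smul_measure (V : ℝ → ℝ) (c : ℝ≥0∞) (μ : Measure E3) :
    rootEnergy V (c • μ) = c.toReal * rootEnergy V μ := by
  rw [rootEnergy, rootEnergy, integral_smul_measure, smul_eq_mul, mul_div_assoc]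

/-- `rootEnergy V (δ_a + δ_b) = (V ‖a‖ + V ‖b‖)/2` for `a ≠ b`. [folklore] -/
theorem rootEnergy_dirac_add_dirac (V : ℝ → ℝ) {a b : E3} (h : a ≠ b) :
    rootEnergy V (Measure.dirac a + Measure.dirac b) = (V ‖a‖ + V ‖b‖) / 2 := by
  classical
  rw [← count_restrict_pair h, ← Finset.coe_pair, rootEnergy_count_restrict_coe_finset,
    Finset.sum_pair h]

/-- **`{c • count|S}` is a measurable set of measures** for `S` countable (cut out by `μ Sᶜ = 0`
and `μ {x} = c`, `x ∈ S`); the `c = 1` case is the landed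
`DiracLaws.measurableSet_singleton_count_restrict`. [folklore] -/
theorem measurableSet_singleton_smul_count_restrict {S : Set E3} (hS : S.Countable) (c : ℝ≥0∞) :
    MeasurableSet ({c • (Measure.count : Measure E3).restrict S} : Set (Measure E3)) := by
  have hSm : MeasurableSet S := hS.measurableSet
  have key : ({c • (Measure.count : Measure E3).restrict S} : Set (Measure E3)) =
      {μ | μ Sᶜ = 0} ∩ ⋂ x ∈ S, {μ | μ {x} = c} := by
    ext μ
    simp only [Set.mem_singleton_iff, Set.mem_inter_iff, Set.mem_setOf_eq, Set.mem_iInter]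
    constructor
    · rintro rfl
      refine ⟨?_, fun x hx => ?_⟩
      · rw [Measure.smul_apply, count_restrict_compl S hSm, smul_zero]
      · rw [Measure.smul_apply, count_restrict_singleton hx, smul_eq_mul, mul_one]
    · rintro ⟨h0, h1⟩
      refine measure_eq_of_compl_null hS h0 ?_ fun x hx => ?_
      · rw [Measure.smul_apply, count_restrict_compl S hSm, smul_zero]
      · rw [h1 x hx, Measure.smul_apply, count_restrict_singleton hx, smul_eq_mul, mul_one]
  rw [key]
  exact (Measure.measurable_coe hSm.compl (measurableSet_singleton 0)).inter
    (MeasurableSet.biInter hS fun x _ =>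
      Measure.measurable_coe (measurableSet_singleton x) (measurableSet_singleton c))

/-- The crux with the hard-core clause `∀ᵐ μ ∂P, IsRootedHardCore δ μ` deleted (and the then idle
binder `∀ δ > 0` dropped): every point-stationary probability law of configuration MEASURES with
`E_P[rootEnergy] ≤ e*` is a.s. relatively dense. -/
def MinimisingLawsCohesiveWithoutHardCore : Prop :=
  ∀ P : Measure (Measure E3), IsProbabilityMeasure P → IsPointStationaryLaw P →
    (∫ μ, rootEnergy lennardJones μ ∂P) ≤
      (⨅ Q : PeriodicConfiguration 3, Q.energyPerParticle lennardJones) →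
    ∀ᵐ μ ∂P, ∃ R₀ : ℝ, ∀ z : E3, ∃ y : E3, μ {y} ≠ 0 ∧ dist z y ≤ R₀

/-- **(H_C) The hard-core clause is load-bearing — the doubled dimer.** Put multiplicity
`m = 2³³` on the root and on ONE neighbour at distance `1`: `ν₁ = m(δ_0 + δ_v)`, `ν₂ = m(δ_0 + δ_{-v})`,
`‖v‖ = 1`, and root uniformly: `P = ½δ_{ν₁} + ½δ_{ν₂}`. Re-rooting swaps `ν₁ ↔ ν₂`
(`θ_v ν₁ = ν₂`, `θ_{-v} ν₂ = ν₁`), so `P` satisfies the Mecke identity VERBATIM; it is a probability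
law; its mean root energy is `m · V_LJ(1)/2 = −2³³/24 = −2³²/12 ≤ e*` (the tree's floor on `e*`,
`neg_le_eStar`) — the `m` coincident particles at the root do not repel because `V_LJ(0) = 0`
(`0⁻¹ = 0`); and the support `{0, ±v}` is bounded, so no sample is relatively dense. Hence any
proof must use that configurations are SIMPLE counting measures: the clause `IsRootedHardCore`
neutralises multiplicity and the `V(0)` junk at once (separation proper, `0 < δ`, is not what this
witness violates: its support is `1`-separated). [folklore] -/
theorem minimisingLawsCohesive_false_without_hardCore : ¬ MinimisingLawsCohesiveWithoutHardCore := by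
  intro H
  -- the doubled dimer, rooted at either end
  set M : ℕ := 2 ^ 33 with hM
  set v : E3 := EuclideanSpace.single 0 1 with hv
  have hv1 : ‖v‖ = 1 := by rw [hv, PiLp.norm_single, norm_one]
  have hv0 : (0 : E3) ≠ v := fun h => by
    have h' := congrArg (fun w : E3 => ‖w‖) h
    simp only [norm_zero, hv1] at h'
    exact zero_ne_one h'
  have hv0' : (0 : E3) ≠ -v := fun h => by
    have h' := congrArg (fun w : E3 => ‖w‖) h
    simp only [norm_zero, norm_neg, hv1] at h'
    exact zero_ne_one h'
  set ν₁ : Measure E3 := (M : ℝ≥0∞) • (Measure.dirac 0 + Measure.dirac v) with hν₁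
  set ν₂ : Measure E3 := (M : ℝ≥0∞) • (Measure.dirac 0 + Measure.dirac (-v)) with hν₂
  -- measurable atoms of the Giry σ-algebra
  have hm₁ : MeasurableSet ({ν₁} : Set (Measure E3)) := by
    rw [hν₁, ← count_restrict_pair hv0]
    exact measurableSet_singleton_smul_count_restrict
      ((Set.finite_singleton v).insert 0).countable _
  have hm₂ : MeasurableSet ({ν₂} : Set (Measure E3)) := by
    rw [hν₂, ← count_restrict_pair hv0']
    exact measurableSet_singleton_smul_count_restrict
      ((Set.finite_singleton (-v)).insert 0).countable _
  -- sums over the two atoms, and re-rooting swaps the two copies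
  have hl₁ : ∀ F : E3 → ℝ≥0∞, ∫⁻ y, F y ∂ν₁ = M * (F 0 + F v) := fun F => by
    rw [hν₁]; exact lintegral_smul_dirac_add_dirac _ _ _ F
  have hl₂ : ∀ F : E3 → ℝ≥0∞, ∫⁻ y, F y ∂ν₂ = M * (F 0 + F (-v)) := fun F => by
    rw [hν₂]; exact lintegral_smul_dirac_add_dirac _ _ _ F
  have hmap₁0 : ν₁.map (fun z => z - 0) = ν₁ := by simp only [sub_zero, Measure.map_id']
  have hmap₂0 : ν₂.map (fun z => z - 0) = ν₂ := by simp only [sub_zero, Measure.map_id']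
  have hmap₁v : ν₁.map (fun z => z - v) = ν₂ := by
    rw [hν₁, hν₂, map_sub_smul_dirac_add_dirac, zero_sub, sub_self, add_comm (Measure.dirac (-v))]
  have hmap₂v : ν₂.map (fun z => z - -v) = ν₁ := by
    rw [hν₂, hν₁, map_sub_smul_dirac_add_dirac, zero_sub, neg_neg, sub_self,
      add_comm (Measure.dirac v)]
  -- the uniformly rooted law
  set P : Measure (Measure E3) :=
    (2⁻¹ : ℝ≥0∞) • Measure.dirac ν₁ + (2⁻¹ : ℝ≥0∞) • Measure.dirac ν₂ with hP
  have hprob : IsProbabilityMeasure P := by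
    refine ⟨?_⟩
    rw [hP, Measure.add_apply, Measure.smul_apply, Measure.smul_apply, measure_univ, measure_univ,
      smul_eq_mul, mul_one, ENNReal.inv_two_add_inv_two]
  have hst : IsPointStationaryLaw P := by
    intro g _
    simp only [hP, lintegral_add_measure, lintegral_smul_measure, lintegral_dirac_of_mem hm₁,
      lintegral_dirac_of_mem hm₂, hl₁, hl₂, hmap₁0, hmap₁v, hmap₂0, hmap₂v, neg_zero, neg_neg]
    ring
  -- the mean root energy: `m · V_LJ(1) / 2` at either root
  have hE₁ : rootEnergy lennardJones ν₁ = -(2 ^ 33 : ℝ) / 24 := by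
    rw [hν₁, rootEnergy_smul_measure, rootEnergy_dirac_add_dirac _ hv0, norm_zero, hv1,
      lennardJones_zero, lennardJones_one, ENNReal.toReal_natCast, hM]
    push_cast
    ring
  have hE₂ : rootEnergy lennardJones ν₂ = -(2 ^ 33 : ℝ) / 24 := by
    rw [hν₂, rootEnergy_smul_measure, rootEnergy_dirac_add_dirac _ hv0', norm_zero, norm_neg, hv1,
      lennardJones_zero, lennardJones_one, ENNReal.toReal_natCast, hM]
    push_cast
    ring
  have hi₁ : Integrable (fun μ : Measure E3 => rootEnergy lennardJones μ) (Measure.dirac ν₁) :=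
    (integrable_congr (ae_dirac_of_mem hm₁
      (p := fun μ => rootEnergy lennardJones μ = rootEnergy lennardJones ν₁) rfl)).2
      (integrable_const _)
  have hi₂ : Integrable (fun μ : Measure E3 => rootEnergy lennardJones μ) (Measure.dirac ν₂) :=
    (integrable_congr (ae_dirac_of_mem hm₂
      (p := fun μ => rootEnergy lennardJones μ = rootEnergy lennardJones ν₂) rfl)).2
      (integrable_const _)
  have h2 : ((2 : ℝ≥0∞)⁻¹).toReal = 2⁻¹ := by simp
  have hI : ∫ μ, rootEnergy lennardJones μ ∂P = -(2 ^ 33 : ℝ) / 24 := by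
    rw [hP, integral_add_measure (hi₁.smul_measure (by simp)) (hi₂.smul_measure (by simp)),
      integral_smul_measure, integral_smul_measure, integral_dirac_of_mem hm₁,
      integral_dirac_of_mem hm₂, hE₁, hE₂, h2, smul_eq_mul]
    ring
  have hEle : (∫ μ, rootEnergy lennardJones μ ∂P) ≤
      (⨅ Q : PeriodicConfiguration 3, Q.energyPerParticle lennardJones) := by
    rw [hI]
    refine le_trans ?_ neg_le_eStar
    norm_num
  -- apply the clause-free crux and read off the atom `ν₁`
  have hconc := H P hprob hst hEle
  rw [ae_iff] at hconc
  set s : Set (Measure E3) := {μ | ¬ ∃ R₀ : ℝ, ∀ z : E3, ∃ y : E3, μ {y} ≠ 0 ∧ dist z y ≤ R₀}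
    with hs
  have hsupp : ∀ y : E3, ν₁ {y} ≠ 0 → ‖y‖ ≤ 1 := by
    intro y hy
    by_contra hgt
    have hy0 : (0 : E3) ∉ ({y} : Set E3) := fun h => by
      rw [mem_singleton_iff] at h
      apply hgt
      rw [← h, norm_zero]
      exact zero_le_one
    have hyv : v ∉ ({y} : Set E3) := fun h => by
      rw [mem_singleton_iff] at h
      apply hgt
      rw [← h, hv1]
    apply hy
    rw [hν₁, Measure.smul_apply, Measure.add_apply,
      Measure.dirac_apply' _ (measurableSet_singleton y),
      Measure.dirac_apply' _ (measurableSet_singleton y), indicator_of_notMem hy0,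
      indicator_of_notMem hyv, add_zero, smul_zero]
  have hmem : ν₁ ∈ s := by
    rintro ⟨R₀, hR⟩
    obtain ⟨y, hy, hzy⟩ := hR (EuclideanSpace.single 0 (|R₀| + 2))
    have h1 : ‖(EuclideanSpace.single 0 (|R₀| + 2) : E3)‖ = |R₀| + 2 := by
      rw [PiLp.norm_single, Real.norm_eq_abs, abs_of_pos (by positivity)]
    have h3 := norm_sub_norm_le (EuclideanSpace.single 0 (|R₀| + 2) : E3) y
    rw [← dist_eq_norm, h1] at h3
    linarith [hsupp y hy, le_abs_self R₀]
  have h1 : (1 : ℝ≥0∞) ≤ Measure.dirac ν₁ s := by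
    refine le_trans (le_of_eq ?_) Measure.le_dirac_apply
    rw [indicator_of_mem hmem, Pi.one_apply]
  have h3 : (2⁻¹ : ℝ≥0∞) ≤ P s := by
    rw [hP, Measure.add_apply, Measure.smul_apply, Measure.smul_apply, smul_eq_mul, smul_eq_mul]
    calc (2⁻¹ : ℝ≥0∞) = 2⁻¹ * 1 := (mul_one _).symm
      _ ≤ 2⁻¹ * Measure.dirac ν₁ s := by gcongr
      _ ≤ _ := le_self_add
  rw [hconc] at h3
  have h4 : (2⁻¹ : ℝ≥0∞) ≠ 0 := by simp
  exact h4 (nonpos_iff_eq_zero.1 h3)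


/-! ## §3 Natural strengthenings

* Relaxed threshold `∫ ≤ e` (`e > e*`): FALSE (landed `not_cohesive_at_relaxed_threshold`) — no
  proof stable under energy perturbations; in particular the uniformly rooted empirical laws of
  finite-`N` ground states (energy `E(N)/N > e*`) are NOT covered and may charge clusters.
* Homogeneity / finite laws: FALSE (`minimisingLawsCohesive_false_without_probability`).
* Uniform radius `∃ R₁(δ), a.s. covering radius ≤ R₁`; "exact ⇒ Delone with density `ρ*`";
  "exact ⇒ no bounded holes": NOT decidable here — every such statement is about the support of an
  exact law, and the only exact law available is the abstract Benjamini–Schramm limit. (The second is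
  believed FALSE-or-open in the wrong direction: periodic porous minimisers are not excluded by the
  crux, which only asks for bounded holes — strategist's S⁺(2).)
* Pointwise version "every hard-core `μ` all of whose points have root energy `≤ e*` is relatively
  dense": would need a LOWER bound on `e*` better than the tree's `−2³²/12` (`neg_le_eStar`) to be
  tested on thick slabs with many near-unit neighbours; with the true `e* ≈ −0.7176` (uncertified)
  and hard core `≲ 0.7` the one-centre minimum lies below `e*` (barriers `IcosahedralClusters`,
  `TetrahedralFrustration`), so the pointwise version is presumably FALSE while the crux may hold —
  cohesion, if true, is a property of the LAW (averaging), not of exact samples. -/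

/-! ## §4 Targets

None served this cycle (`payload.targets = []`, `stuck_stubs = []`). -/

/-! ## §5 Line `purity_stacking` (PICKED) — stub audit, cycle 1

Verdict per registered stub of `Lines/purity_stacking.lean` (signatures as filed; cheap attacks:
degenerate inputs, junk models, quantifier reading, paper re-derivation). NO STUB BROKEN.

* (A) `stub_measurableClass` — TRUE on paper (separated `Y`: membership of `count|A(Y − q)` in the
  single-root class is a countable Boolean combination of ball counts over a countable dense set of
  frames; standard). Degenerate `Y = ∅`: the class is `{0}`-or-empty, measurable. No attack.
* (G) `stub_symDiscontinuous` — TRUE: `g(Y) = Y`, `‖x‖, ‖g x‖ ≤ R` ⇒ for four affinely independent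
  `y_i ∈ Y` (they exist: the non-coplanarity hypothesis `¬∃ n ≠ 0, ∃ c, ∀ y ∈ Y, ⟪y, n⟫ = c` EXCLUDES
  `Y = ∅` and singletons/collinear/coplanar sets, see `coplanar_empty` below) `g y_i ∈ Y ∩ B̄(0,
  ‖y_i‖ + 2R)`, a finite set (separation), and an affine isometry is determined by four affinely
  independent images. For `R < 0` the set is empty.
* (F) `stub_groupStructure` — TRUE = Thurston 4.2.2(a) + 4.2.5 (`discreteEuclideanGroupStructure 3`,
  a named fact `def`, unproved in tree): (i) a finite `H ≤ Γ` meets the torsion-free finite-index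
  `A` trivially, so `h ↦ hA` is injective and `|H| ≤ [Γ : A]`; (ii) `m = 3` ⇒ `A ≅ ℤ³` acts by
  translations on `V = ℝ³`, its vectors form a discrete rank-3 subgroup of `ℝ³`, hence 3 linearly
  independent translations; `m ≤ 2` ⇒ `V` is the invariant proper subspace. Tested: trivial group
  (`isDiscontinuous_bot`; point invariant), pure translation `ℤ`, infinite dihedral with reflection or
  `π`-rotation, irrational screw (torsion-free, invariant axis), glide reflections — all consistent;
  the would-be counterexamples (irrational rotation, translation ∥ irrational screw) are not
  discontinuous.
* (B) `stub_pureExhaustion` — TRUE given its antecedents: charged classes are disjoint measurable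
  (A; an `Y` that is not `δ`-separated has `Cls Y` inside the null set, outer measure `0`, so X₁'s `Y`
  is separated), at most countably many; `Cᶜ` is re-rooting invariant (`θ_y` of a rooted copy of `Y`
  at a point is a rooted copy of `Y`); conditioning on an invariant event keeps Mecke and hard core,
  and the FLOOR keeps `≤ e*`; X₁ on the conditioned law yields a charged class inside `Cᶜ` — absurd.
* (C) `stub_finiteOrbitsOfCharged` — TRUE (re-derived): with `K_a` the single-root classes,
  `Cls Y = ⊔_{[a] ∈ Y/Γ} K_a` (`K_a ∩ K_b ≠ ∅ ⇒ b ∈ Γa`), Mecke with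
  `g = 1_{K_a}(μ) 1_{K_b}(θ_y μ) 1{‖y‖ ≤ r}` gives `m(a)·#(Γb ∩ B̄(a,r)) = m(b)·#(Γa ∩ B̄(b,r))`
  (the counts are constant on `K_a`, resp. `K_b`); `#(Γb ∩ B̄(a,r)) = N/|Stab_b|`,
  `#(Γa ∩ B̄(b,r)) = N/|Stab_a|` with the same `N = #{γ : ‖γb − a‖ ≤ r}` (`γ ↦ γ⁻¹`), finite by (G)
  and positive for `r ≥ ‖a − b‖`; so `m(a)|Stab_a| = m(b)|Stab_b| = κ > 0` and, by (F)(i),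
  `m(b) ≥ κ/N_max`, whence `#(Y/Γ) ≤ N_max/κ`. Candidate counterexamples all fail: canopy-type sets
  need a non-discrete symmetry group (impossible, separated non-coplanar); half-crystal / aperiodic
  layer stackings carry NO point-stationary atom (equal masses on infinitely many classes); uniform
  rooting of a finite asymmetric cluster: finitely many orbits trivially (`finiteOrbits_of_finite`).
* (D) `stub_slabOrDense` — TRUE: `μ = count|A(Y−q)` hard-core ⇒ `Y` separated; coplanar ⇒ slab;
  else (G)+(F): three translations ⇒ `Y ⊇ y + L`, relatively dense (transported by the onto linear
  isometry `A`); invariant `V` with `dim ≤ 2` ⇒ `dist(γx, V) = dist(x, V)`, finitely many orbit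
  representatives ⇒ `Y ⊆ N_D(V)` ⇒ slab. `Y` finite: hypothesis free (`finiteOrbits_of_finite`),
  conclusion `Slab` ✓.
* (E) `stub_noSlabs` — TRUE on paper, and the lead's reshaping is an IMPROVEMENT: stacking along a
  COORDINATE axis `e_j` at an integer period `t` on the countably many invariant measurable events
  `G_{j,t}` ("all cross differences avoid `ℤ⋆ t e_j + B(0,1)`") needs no measurable selection of a
  normal; every slab lies in some `G_{j,t}` (`|⟪e_j, n₀⟫| ≥ 1/√3` for some `j`, `t ≥ √3(w+2)`);
  on `G_{j,t}` the stacked configuration is `min(δ,1)`-hard-core, all cross terms have `r ≥ 1`, hence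
  `V_LJ(r) ≤ 0` with `V_LJ(t) < 0` (`lennardJones_neg`, `t > 1`), the cross sum is absolutely
  convergent and uniformly bounded on `G_{j,t} ∩ {δ-hard-core}` (`O(r²·t⁻⁶k⁻⁶)` shells), and the
  stacked law is point-stationary by Mecke for `P|G` with `G(μ,y) = Σ_k g(Stack μ, y + kte_j)`.
  NOTE for the lead: the argument proves MORE — a minimising law charges no self-stackable
  configuration at all (`P(G_{j,t}) = 0` for all `j,t`), slab or not; state (E) that way if cheaper.
  The floor is used twice (conditioning keeps `≤ e*`; contradiction `< e*`).

Residual risk of the line = its declared input X₁ (`MinimisingLawsHaveAtoms`, open-problem class),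
not a stub. -/

/-- Calibration for (G)/(C): the empty set IS "coplanar" in the sense of the stubs' hypothesis, so
the non-coplanarity clause excludes it (and every subset of a plane). -/
theorem coplanar_empty :
    ∃ n : E3, n ≠ 0 ∧ ∃ c : ℝ, ∀ y ∈ (∅ : Set E3), inner ℝ y n = c := by
  refine ⟨EuclideanSpace.single 0 1, fun h => ?_, 0, fun y hy => hy.elim⟩
  have h' := congrArg (fun w : E3 => ‖w‖) h
  simp only [PiLp.norm_single, norm_one, norm_zero] at h'
  exact one_ne_zero h'

/-- Calibration for (C)/(D): a finite set has finitely many symmetry orbits for free (`g = id`), so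
(D) must, and does, send finite clusters to the `Slab` branch. -/
theorem finiteOrbits_of_finite (Y : Finset E3) :
    Literature.Geometry.DiscreteGeometry.HasFinitelyManySymmetryOrbits (↑Y : Set E3) :=
  ⟨Y, fun x hx => ⟨AffineIsometryEquiv.refl ℝ E3, by simp, by simpa using hx⟩⟩

/-! ## §6 Why it resists — the standing kill target (no `sorry`) -/

/-- **KILL TARGET** (NOT claimed — believed false): an exact, non-cohesive minimising law. By
`killTarget_iff_not_crux` this is literally `¬ MinimisingLawsCohesive`. Obstructions, in order:
(1) `e* = ⨅_Q e_LJ(Q)` has no closed form and no certified enclosure in the tree beyond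
`−2³²/12 ≤ e* ≤ −1/24` (`neg_le_eStar`, `eStar_le_neg`); certifying `∫ rootEnergy dP = e*` for ANY
explicit `P` would identify the optimal periodic Lennard-Jones configuration — the crystal problem
itself; the only exact law in hand is the abstract Benjamini–Schramm limit (`exists_minimising_law`),
about whose support nothing is known. (2) Mixtures do not help: by the floor the exact laws form a
FACE, so every component of a counterexample is itself exact (`minimising_iff_exact`). (3)
Zero-density defects (holes along a sparse sequence) are invisible to a point-stationary law; holes
of unbounded size at positive intensity must be energetically FREE at coexistence `μ = e*` — zero
surface tension of Lennard-Jones matter at `T = 0`, believed false and open in `d = 3` (Blanc–Lewin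
2015 §2.3; no porous or filmy exact LJ ground state in print — presearch 2026-08-17, corpus +
galaxy, none). (4) Lower-dimensional witnesses (films, rods, finite clusters, the rooted comb) are
killed on paper by self-stacking against the PROVED floor (§5 (E)); without the floor they would only
reach `e* + 0`. (5) The `δ`-decoupling (hard core not tied to the LJ length) buys nothing under
Mecke: a root with `k` near-unit neighbours at mutual distance `δ ≪ 1` is averaged against those
neighbours' `δ⁻¹²` repulsion (`RootedComb` is exactly the non-stationary version). -/
def KillTarget : Prop :=
  ∃ δ : ℝ, 0 < δ ∧ ∃ P : Measure (Measure E3), IsProbabilityMeasure P ∧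
    (∀ᵐ μ ∂P, IsRootedHardCore δ μ) ∧ IsPointStationaryLaw P ∧
    (∫ μ, rootEnergy lennardJones μ ∂P) = eStar ∧ ¬ ∀ᵐ μ ∂P, RelDense μ

/-- The kill target is exactly the negation of the crux. [folklore] -/
theorem killTarget_iff_not_crux : KillTarget ↔ ¬ MinimisingLawsCohesive :=
  not_minimisingLawsCohesive_iff.symm

end Summit.AtomisticToContinuum.Crystallization.Cruxes.MinimisingLawsCohesive.Disproof

end
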